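import Mathlib.Data.Finset.Card
import Mathlib.Data.ENat.Lattice
import Literature.Computability.Complexity.CNF
import Literature.Computability.MetaComplexity.Resolution
import HarnessLib

-- provenance: harness21/H21/H21/Prelude/CplxMeta/ResLin.lean @ 8a3fbaf (interim HEAD d8f2665); M5 mechanical rewrite
/-!
# Complexity meta: resolution over parities Res(⊕)

Trunk `CplxMeta`, concept C9 (outline `H21/Outlines/CplxMeta.md`): the proof system Res(⊕)
(resolution over linear equations mod 2) of Itsykson–Sokolov, formalised in the same style as
resolution (`Literature.Prelude.CplxMeta.Resolution`): a derivation is a list of justified lines, each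
line carrying a *linear clause* — a finite disjunction of affine equations
`⊕_{i ∈ S} xᵢ = b` over `𝔽₂` — and the rule producing it. The rules are

* `initial`: a clause of the refuted CNF, read as a linear clause (a literal `x` / `¬x` is the
  equation `x = 1` / `x = 0`);
* `resolve i j f`: from earlier lines `C ∨ (f = 0)` and `D ∨ (f = 1)` derive `C ∨ D`;
* `weaken i`: *semantic* weakening, derive any linear clause implied by earlier line `i`
  (Itsykson–Sokolov allow this since implication between linear clauses is decidable in
  polynomial time).

Size is the number of lines, depth is read off the premise DAG through C8's `dagDepth`, and the
minimal refutation size is `ℕ∞`-valued.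

## Mathlib search

Mathlib has no propositional proof systems (its "resolutions" are homological) and no Res(⊕);
nothing to reuse beyond `Finset.card`/`Finset.filter` (parity as `card % 2`, so `ZMod 2` is not
needed) and `ℕ∞` infima.

## Design notes

* Variables are `ℕ` (as for the hard formulas of C8); a linear form is a `Finset ℕ` (the support
  `S` of `⊕_{i ∈ S} xᵢ`), an equation is `LinLit := Finset ℕ × Bool`, a linear clause is a
  `Finset LinLit`. The empty linear clause is false; note that e.g. `{(∅, true)}` (the equation
  `0 = 1`) is also identically false but is *not* the empty clause — a refutation must end in `∅`
  (one semantic weakening step converts any identically false clause into `∅`).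
* `Literal.toLinLit`, `Clause.toLinClause` are dot-extensions declared in G01's namespace
  `Literature.CplxCore` so that `l.toLinLit`, `c.toLinClause` elaborate.
* `IsResLinDerivation φ π := ∀ k, IsValidResLinLine φ (π.take k) π[k]`, exactly as for
  resolution; premise indices point into the prefix.
* **Regular Res(⊕) is deliberately not defined**: the literature has two inequivalent notions
  (bottom-regular and top-regular Res(⊕), cf. Efremenko–Garlík–Itsykson, and Gryaznov 2019),
  and no target statement of v0 fixes one (outline R5).
* `resLinDepth` is only meaningful on valid derivations (junk `0` contributions from
  out-of-range indices, as for `resDepth`).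

## References

* D. Itsykson, D. Sokolov, *Lower bounds for splittings by linear combinations*, MFCS 2014;
  journal version *Resolution over linear equations modulo two*, Ann. Pure Appl. Logic 171
  (2020), §2 (the system Res(⊕): rules "resolution" and semantic "weakening"; soundness,
  completeness, simulation of resolution).
* J. Krajíček, *Proof Complexity*, CUP 2019, §7.1 (R(LIN)).
-/

namespace Literature.Computability.MetaComplexity

open _root_.Computability Complexity

/-! ### Linear literals and linear clauses -/

/-- A *linear literal* (affine equation over `𝔽₂`): the pair `(S, b)` stands for the equation
`⊕_{i ∈ S} xᵢ = b`. [Itsykson–Sokolov 2020, §2 (linear clauses as disjunctions of equations)] [cite: ItsyksonSokolov2020, §2 (linear clauses as disjunctions of eq] -/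
abbrev LinLit : Type := Finset ℕ × Bool

/-- The value of the equation `⊕_{i ∈ S} xᵢ = b` under `σ`: the number of `i ∈ S` with
`σ i = true` has parity `b`. [Itsykson–Sokolov 2020, §2] [cite: ItsyksonSokolov2020, §2] -/
def LinLit.eval (σ : ℕ → Bool) (l : LinLit) : Bool :=
  decide ((l.1.filter fun i => σ i = true).card % 2 = l.2.toNat)

/-- A *linear clause*: a finite disjunction of linear literals (equivalently, the negation of a
linear system over `𝔽₂`). The empty linear clause is false. [Itsykson–Sokolov 2020, §2] [cite: ItsyksonSokolov2020, §2] -/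
abbrev LinClause : Type := Finset LinLit

/-- The value of a linear clause: some of its equations holds. [Itsykson–Sokolov 2020, §2] [cite: ItsyksonSokolov2020, §2] -/
def LinClause.eval (σ : ℕ → Bool) (C : LinClause) : Bool :=
  decide (∃ l ∈ C, l.eval σ = true)

/-- A propositional literal as a linear literal: `x ↦ (x = 1)`, `¬x ↦ (x = 0)`. Declared in
G01's namespace `Literature.Computability.Complexity.Literal` as a dot-extension. [Itsykson–Sokolov 2020, §2
(clauses of a CNF as linear clauses)] [cite: ItsyksonSokolov2020, §2 (clauses of a CNF as linear clauses] -/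
def _root_.Literature.Computability.Complexity.Literal.toLinLit (l : Literal ℕ) : LinLit :=
  ({l.1}, l.2)

/-- A propositional clause as a linear clause (literal-wise, duplicates merged). Declared in
G01's namespace `Literature.Computability.Complexity.Clause` as a dot-extension. [Itsykson–Sokolov 2020, §2] [cite: ItsyksonSokolov2020, §2] -/
def _root_.Literature.Computability.Complexity.Clause.toLinClause (c : Clause ℕ) : LinClause :=
  (c.map Literal.toLinLit).toFinset

/-- The translation of a literal is semantically faithful. [Itsykson–Sokolov 2020, §2] [cite: ItsyksonSokolov2020, §2] -/
@[simp] theorem eval_toLinLit (l : Literal ℕ) (σ : ℕ → Bool) :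
    l.toLinLit.eval σ = l.eval σ := by
  rcases l with ⟨x, b⟩
  cases b <;> cases h : σ x <;> simp [LinLit.eval, Literal.toLinLit, Literal.eval,
    Finset.filter_singleton, h]

/-- The translation of a clause is semantically faithful. [Itsykson–Sokolov 2020, §2] [cite: ItsyksonSokolov2020, §2] -/
theorem eval_toLinClause (c : Clause ℕ) (σ : ℕ → Bool) :
    (Clause.toLinClause c).eval σ = c.any (Literal.eval σ) := by
  apply Bool.eq_iff_iff.2
  simp only [LinClause.eval, Clause.toLinClause, decide_eq_true_eq, List.mem_toFinset,
    List.mem_map, List.any_eq_true]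
  constructor
  · rintro ⟨_, ⟨l, hl, rfl⟩, h⟩
    exact ⟨l, hl, by simpa using h⟩
  · rintro ⟨l, hl, h⟩
    exact ⟨l.toLinLit, ⟨l, hl, rfl⟩, by simpa using h⟩

/-! ### Lines, derivations, refutations -/

/-- The justification of a line of a Res(⊕) derivation: an initial clause of the CNF, the
resolvent of earlier lines `i` (containing `f = 0`) and `j` (containing `f = 1`) on the linear
form `f = ⊕_{i ∈ f} xᵢ`, or a semantic weakening of earlier line `i`.
[Itsykson–Sokolov 2020, §2 (rules of Res(⊕))] [cite: ItsyksonSokolov2020, §2 (rules of Res(⊕] -/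
inductive ResLinRule
  /-- an initial clause of the refuted CNF -/
  | initial : ResLinRule
  /-- resolution of lines `i` (containing `f = 0`) and `j` (containing `f = 1`) on `f` -/
  | resolve (i j : ℕ) (f : Finset ℕ) : ResLinRule
  /-- semantic weakening of line `i` -/
  | weaken (i : ℕ) : ResLinRule
  deriving DecidableEq

/-- The premise indices of a rule application (`[]`, `[i, j]` or `[i]`).
[Itsykson–Sokolov 2020, §2] [cite: ItsyksonSokolov2020, §2] -/
def ResLinRule.premises : ResLinRule → List ℕ
  | .initial => []
  | .resolve i j _ => [i, j]
  | .weaken i => [i]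

/-- A line of a Res(⊕) derivation: a linear clause together with its justification.
[Itsykson–Sokolov 2020, §2] [cite: ItsyksonSokolov2020, §2] -/
structure ResLinLine where
  /-- the linear clause derived at this line -/
  clause : LinClause
  /-- the rule application justifying it -/
  rule : ResLinRule

/-- The premise indices of a line. [Itsykson–Sokolov 2020, §2] [cite: ItsyksonSokolov2020, §2] -/
def ResLinLine.premises (l : ResLinLine) : List ℕ :=
  l.rule.premises

/-- Validity of a line `l` given the earlier lines `prev` and the refuted CNF `φ`: an `initial`
line is (the translation of) a clause of `φ`; a `resolve i j f` line is `C ∪ D` where earlier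
lines `i, j` are `C ∨ (f = 0)` and `D ∨ (f = 1)`; a `weaken i` line is semantically implied by
earlier line `i`. [Itsykson–Sokolov 2020, §2 (resolution rule and weakening rule)] [cite: ItsyksonSokolov2020, §2 (resolution rule and weakening rule] -/
def IsValidResLinLine (φ : CNF ℕ) (prev : List ResLinLine) (l : ResLinLine) : Prop :=
  match l.rule with
  | .initial => ∃ c ∈ φ, l.clause = Clause.toLinClause c
  | .resolve i j f => ∃ hi : i < prev.length, ∃ hj : j < prev.length, ∃ C D : LinClause,
      (prev[i]'hi).clause = insert (f, false) C ∧ (prev[j]'hj).clause = insert (f, true) D ∧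
        l.clause = C ∪ D
  | .weaken i => ∃ hi : i < prev.length,
      ∀ σ : ℕ → Bool, (prev[i]'hi).clause.eval σ = true → l.clause.eval σ = true

/-- `π` is a Res(⊕) derivation from `φ`: every line is valid with respect to the lines before
it. The length `π.length` is the (dag-like) size. [Itsykson–Sokolov 2020, §2] [cite: ItsyksonSokolov2020, §2] -/
def IsResLinDerivation (φ : CNF ℕ) (π : List ResLinLine) : Prop :=
  ∀ k (hk : k < π.length), IsValidResLinLine φ (π.take k) (π[k]'hk)

/-- `π` is a Res(⊕) refutation of `φ`: a derivation from `φ` containing the empty linear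
clause. [Itsykson–Sokolov 2020, §2] [cite: ItsyksonSokolov2020, §2] -/
def IsResLinRefutation (φ : CNF ℕ) (π : List ResLinLine) : Prop :=
  IsResLinDerivation φ π ∧ ∃ l ∈ π, l.clause = ∅

/-- Soundness of Res(⊕): a refuted CNF is unsatisfiable. [Itsykson–Sokolov 2020, §2] [cite: ItsyksonSokolov2020, §2] -/
def not_satisfiable_of_isResLinRefutation : Prop :=
  ∀ {φ : CNF ℕ} {π : List ResLinLine} (h : IsResLinRefutation φ π),
    ¬ φ.Satisfiable

/-- Res(⊕) simulates resolution: a resolution refutation of `φ` yields a Res(⊕) refutation with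
at most `|φ|` extra lines (initial clauses are re-derived literally; a resolution weakening
step is a semantic weakening; a resolution step on `v` is a Res(⊕) step on the form `xᵥ`).
[Itsykson–Sokolov 2020, §2 (Res(⊕) p-simulates resolution)] [cite: ItsyksonSokolov2020, §2 (Res(⊕] -/
def exists_isResLinRefutation_of_isResRefutation : Prop :=
  ∀ {φ : CNF ℕ} {π : List (ResLine ℕ)} (h : IsResRefutation φ π),
    ∃ π' : List ResLinLine, IsResLinRefutation φ π' ∧ π'.length ≤ π.length + φ.length

/-! ### Measures: depth and minimal size -/

/-- The depth of a Res(⊕) derivation: the longest premise chain (`dagDepth` of its premise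
structure). Only meaningful on valid derivations. [Itsykson–Sokolov 2020, §2 (proofs as
DAGs); Krajíček 2019, §5.1 (height)] [cite: ItsyksonSokolov2020, §2 (proofs as DAGs] -/
def resLinDepth (π : List ResLinLine) : ℕ :=
  dagDepth (π.map ResLinLine.premises)

/-- `l.foldr max 0 ≤ n` iff every entry is `≤ n` (helper). [Krajíček 2019, §5.1] [folklore] -/
private theorem foldr_max_zero_le_iff (l : List ℕ) (n : ℕ) :
    l.foldr max 0 ≤ n ↔ ∀ x ∈ l, x ≤ n := by
  induction l with
  | nil => simp
  | cons a l ih => simp [ih]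

/-- `List.getD` with default `0` respects an entrywise bound (helper). [Krajíček 2019, §5.1] [folklore] -/
private theorem getD_le_of_forall_le {l : List ℕ} {n : ℕ} (h : ∀ x ∈ l, x ≤ n) (i : ℕ) :
    l.getD i 0 ≤ n := by
  rw [List.getD_eq_getElem?_getD]
  cases hi : l[i]? with
  | none => simp
  | some x => simpa using h x (List.mem_of_getElem? hi)

/-- Every node of a premise DAG has depth at most the number of nodes (generic helper for
`dagDepth`). [Krajíček 2019, §5.1] [folklore] -/
theorem forall_mem_dagDepthList_le (prem : List (List ℕ)) :
    ∀ d ∈ dagDepthList prem, d ≤ prem.length := by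
  induction prem using List.reverseRecOn with
  | nil => simp [dagDepthList]
  | append_singleton xs ps ih =>
    have hxs : dagDepthList (xs ++ [ps]) = dagDepthList xs ++
        [(ps.map fun i => (dagDepthList xs).getD i 0 + 1).foldr max 0] := by
      simp [dagDepthList, List.foldl_append]
    rw [hxs]
    intro d hd
    simp only [List.mem_append, List.mem_singleton, List.length_append,
      List.length_singleton] at hd ⊢
    rcases hd with hd | rfl
    · exact (ih d hd).trans (Nat.le_succ _)
    · rw [Literature.Computability.MetaComplexity.foldr_max_zero_le_iff]
      intro x hx
      obtain ⟨i, -, rfl⟩ := List.mem_map.1 hx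
      exact Nat.succ_le_succ (getD_le_of_forall_le ih i)

/-- The depth of a premise DAG is at most its number of nodes. [Krajíček 2019, §5.1] [folklore] -/
theorem dagDepth_le_length (prem : List (List ℕ)) : dagDepth prem ≤ prem.length :=
  (Literature.Computability.MetaComplexity.foldr_max_zero_le_iff _ _).2 (forall_mem_dagDepthList_le prem)

/-- The depth of a derivation is at most its number of lines. [Krajíček 2019, §5.1] [folklore] -/
theorem resLinDepth_le_length (π : List ResLinLine) : resLinDepth π ≤ π.length := by
  simpa [resLinDepth] using dagDepth_le_length (π.map ResLinLine.premises)

/-- The minimal size (number of lines) of a Res(⊕) refutation of `φ`, in `ℕ∞` (`⊤` iff `φ` has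
no refutation, i.e. iff `φ` is satisfiable). [Itsykson–Sokolov 2020, §2] [cite: ItsyksonSokolov2020, §2] -/
noncomputable def minResLinRefutationSize (φ : CNF ℕ) : ℕ∞ :=
  ⨅ (π : List ResLinLine) (_ : IsResLinRefutation φ π), (π.length : ℕ∞)

/-- A refutation bounds the minimal refutation size. [Itsykson–Sokolov 2020, §2] [cite: ItsyksonSokolov2020, §2] -/
theorem minResLinRefutationSize_le_length {φ : CNF ℕ} {π : List ResLinLine}
    (h : IsResLinRefutation φ π) : minResLinRefutationSize φ ≤ π.length :=
  iInf₂_le π h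

/-- Res(⊕) refutations are at most `|φ|` lines longer than resolution refutations.
[Itsykson–Sokolov 2020, §2] [cite: ItsyksonSokolov2020, §2] -/
def minResLinRefutationSize_le : Prop :=
  ∀ (φ : CNF ℕ),
    minResLinRefutationSize φ ≤ minResRefutationSize φ + φ.length

end Literature.Computability.MetaComplexity
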